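import Summits.BirchSwinnertonDyer.BirchSwinnertonDyer.Theorems.ByReductionTypeAtTwoFineSelmerConjAAtTwoAdditivePotGoodCapitulationDoor
import HarnessLib

/-!
# The capitulation door at the first layer of the cyclotomic `ℤ₂`-tower: `e₁ = e₀` from one ambiguous class

Sub-problem `BirchSwinnertonDyer`, route `ByReductionTypeAtTwo`, item `FineSelmerConjAAtTwoAdditivePotGood` (C1″), helper file
(companion of `…CapitulationDoor`).  For `K` of odd degree with at most one prime above `2` and `κ` its cyclotomic
`ℤ₂`-extension, the first layer is `K₁ = K(√2)` (`exists_sq_eq_two_layer_one_of_not_dvd_finrank`), Galois of degree `2`,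
unramified at infinity (`isUnramifiedAtInfinitePlaces_of_sq_eq_two`) and ramified at most at the prime above `2`; so the door
`padicValNat_two_classNumber_eq_of_ambiguous` turns ONE `Gal(K₁/K)`-fixed class `c ∈ Cl(K₁)` with `h_K ∣ m·ord(N c)`, `m` odd,
into the displayed hypothesis `classNumberPExp κ 1 = classNumberPExp κ 0` of the census stamps `conjA_two_<L>_of_fukudaLayers`
(the 8 «Fukuda rows»).  The per-row construction of `c` (a prime of `K₁` above a split prime `𝔮` of `K` generating `Cl(K)`) is
left to the stamps.

## What this does NOT prove
No certificate is built here; nothing about Selmer groups.  BSD is not advanced by this file.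
-/

set_option autoImplicit false
set_option linter.dupNamespace false

noncomputable section

open scoped Classical NumberField nonZeroDivisors

namespace Summit.BirchSwinnertonDyer.BirchSwinnertonDyer.Theorems.AddKatoTwo

open NumberField IsDedekindDomain
open Literature.NumberTheory.NumberFields Literature.NumberTheory.NumberFields.AmbiguousClass
  Literature.NumberTheory.GaloisRepresentations
  Literature.NumberTheory.GaloisRepresentations.Herbrand Literature.NumberTheory.GaloisRepresentations.MinkowskiUnit
  Literature.NumberTheory.GaloisRepresentations.CyclicNormIndex

/-! ## The first layer of the cyclotomic `ℤ₂`-extension: `e₁ = e₀` from one ambiguous class -/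

section LayerOne

variable {K : Type} [Field K] [NumberField K]

open Literature.NumberTheory.IwasawaTheory Literature.NumberTheory.EllipticCurves

/-- **`e₁ = e₀` along the cyclotomic `ℤ₂`-tower, certified by one ambiguous class.**  `K` of odd degree with at most ONE prime above `2`,
`κ` its cyclotomic `ℤ₂`-extension, `K₁ = K(√2)` the first layer.  If some class `c ∈ Cl(K₁)` is fixed by `Gal(K₁/K)` and
`h_K ∣ m · ord(N_{K₁/K} c)` with `m` odd, then `classNumberPExp κ 1 = classNumberPExp κ 0` — the displayed hypothesis of the census
stamps `conjA_two_<L>_of_fukudaLayers` (Fukuda's criterion with `n₀ = 0`). [cite: Lang1990, Ch. 13 §4, Lemma 4.1] [cite: Gras2003, II.6.2.3] -/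
theorem classNumberPExp_one_eq_classNumberPExp_zero_of_ambiguous (hK2 : ¬ 2 ∣ Module.finrank ℚ K) (κ : ZpExtension K 2)
    (hκ : κ.IsCyclotomic) (hs1 : {v : HeightOneSpectrum (𝓞 K) | ((2 : ℕ) : 𝓞 K) ∈ v.asIdeal}.ncard ≤ 1)
    (hcert : haveI : FiniteDimensional K (κ.layer 1) := κ.finiteDimensional_layer_holds 1;
      haveI : NumberField (κ.layer 1) := NumberField.of_module_finite K (κ.layer 1);
      ∃ (c : ClassGroup (𝓞 (κ.layer 1))) (m : ℕ), Odd m ∧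
        (∀ τ : κ.layer 1 ≃ₐ[K] κ.layer 1, ClassGroup.mulEquiv (intAut τ) c = c) ∧
        classNumber K ∣ m * orderOf (classGroupNorm K (κ.layer 1) c)) :
    classNumberPExp κ 1 = classNumberPExp κ 0 := by
  classical
  haveI : FiniteDimensional K (κ.layer 1) := κ.finiteDimensional_layer_holds 1
  haveI : IsGalois K (κ.layer 1) := κ.isGalois_layer_holds 1
  haveI : NumberField (κ.layer 1) := NumberField.of_module_finite K (κ.layer 1)
  obtain ⟨c, m, hm, hc, hN⟩ := hcert
  set L := κ.layer 1 with hL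
  have hdeg : Module.finrank K L = 2 := by rw [hL, κ.finrank_layer_holds 1, pow_one]
  obtain ⟨s, hs2⟩ := exists_sq_eq_two_layer_one_of_not_dvd_finrank hK2 κ hκ
  have hsK : ∀ c : K, algebraMap K L c ≠ s := by
    intro c hc
    apply sq_ne_two_of_odd_finrank hK2 c
    apply (algebraMap K L).injective
    rw [map_pow, hc, hs2, map_ofNat]
  have hli : LinearIndependent K ![(1 : L), s] := by
    refine LinearIndependent.pair_iff.mpr fun a b hab => ?_
    by_cases hb : b = 0
    · subst hb
      simp only [zero_smul, add_zero, smul_eq_zero, one_ne_zero, or_false] at hab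
      exact ⟨hab, rfl⟩
    · exfalso
      apply hsK (-(a / b))
      rw [Algebra.smul_def, Algebra.smul_def, mul_one] at hab
      have hb' : algebraMap K L b ≠ 0 := by rwa [Ne, map_eq_zero]
      rw [map_neg, map_div₀, ← neg_div, div_eq_iff hb']
      linear_combination (-1 : L) * hab
  have hspan : ∀ x : L, ∃ a b : K, x = algebraMap K L a + algebraMap K L b * s := by
    intro x
    let B : Module.Basis (Fin 2) K L := basisOfLinearIndependentOfCardEqFinrank hli (by simp [hdeg])
    have hB : ∀ i, B i = ![(1 : L), s] i := fun i => by simp [B, coe_basisOfLinearIndependentOfCardEqFinrank]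
    refine ⟨B.repr x 0, B.repr x 1, ?_⟩
    conv_lhs => rw [← B.sum_repr x]
    rw [Fin.sum_univ_two, hB, hB, Algebra.smul_def, Algebra.smul_def]
    simp
  haveI : IsUnramifiedAtInfinitePlaces K L := isUnramifiedAtInfinitePlaces_of_sq_eq_two hs2 hspan
  -- at most one ramified prime
  have ht : {v : HeightOneSpectrum (𝓞 K) | v.asIdeal.ramificationIdxIn (𝓞 L) ≠ 1}.ncard ≤ 1 := by
    have h20 : Ideal.span {((2 : ℕ) : 𝓞 K)} ≠ ⊥ := by
      rw [Ne, Ideal.span_singleton_eq_bot]; exact_mod_cast Nat.prime_two.ne_zero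
    have hfin : {v : HeightOneSpectrum (𝓞 K) | ((2 : ℕ) : 𝓞 K) ∈ v.asIdeal}.Finite := by
      refine (Ideal.finite_factors h20).subset fun v hv => ?_
      exact (Ideal.dvd_span_singleton).mpr hv
    refine le_trans (Set.ncard_le_ncard (fun v hv => ?_) hfin) hs1
    by_contra hpv
    apply hv
    have hunr := κ.isUnramifiedIn_layer_of_not_mem 1 hpv
    haveI : v.asIdeal.IsPrime := v.isPrime
    obtain ⟨⟨P, hPprime, hPover⟩⟩ := (inferInstance : Nonempty (Ideal.primesOver v.asIdeal (𝓞 L)))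
    haveI := hPprime
    haveI := hPover
    rw [Ideal.ramificationIdxIn_eq_ramificationIdx v.asIdeal P (L ≃ₐ[K] L)]
    exact hunr.ramificationIdx_eq_one hPover
  -- the door at layer 1, and `h(K_0) = h(K)`
  have h1 : classNumberPExp κ 1 = padicValNat 2 (classNumber K) := by
    rw [classNumberPExp_eq_padicValNat_classNumber]
    exact padicValNat_two_classNumber_eq_of_ambiguous hdeg ht hc hm hN
  have h0 : classNumberPExp κ 0 = padicValNat 2 (classNumber K) := by
    haveI : FiniteDimensional K (κ.layer 0) := κ.finiteDimensional_layer_holds 0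
    haveI : NumberField (κ.layer 0) := NumberField.of_module_finite K (κ.layer 0)
    rw [classNumberPExp_eq_padicValNat_classNumber]
    have e : (κ.layer 0) ≃ₐ[K] K :=
      (IntermediateField.equivOfEq κ.layer_zero).trans (IntermediateField.botEquiv K _)
    have hcl : classNumber (κ.layer 0) = classNumber K :=
      Fintype.card_congr (ClassGroup.mulEquiv (RingOfIntegers.mapRingEquiv e.toRingEquiv)).toEquiv
    rw [hcl]
  rw [h1, h0]

end LayerOne

end Summit.BirchSwinnertonDyer.BirchSwinnertonDyer.Theorems.AddKatoTwo

end
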